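import Summits.ValiantsHypothesis.ValiantsHypothesis.Theses.KPlusLogSqLaw
import Summits.ValiantsHypothesis.ValiantsHypothesis.Theorems.LacunarySymmetroidMatrixDescartesCensusTropicalKLaw
import Summits.ValiantsHypothesis.ValiantsHypothesis.Theorems.LacunarySymmetroidMatrixDescartesStubNegRoots

/-!
# Sketch — crux idea «tower-graft» for `WeakLifting` (stmt-ValiantsHypothesis-19561), seat val-idea-24 (e)

Statements only (`Prop`s); nothing asserted.  TOWER supports (`m·d l < d l'` for `l < l'`) are the lex chambers of
the `m`-fold sum arrangement: all `C(m+K-1,m)` exponents `⟨n,d⟩` are distinct, Descartes is maximal, and the record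
staircase family lives here.  The idea: B on towers via a ONE-LETTER GRAFT LAW proved through the bivariate pencil
determinant `Q(t,T) = det(G(t) + T·S)` read on the monomial arc `T = t^D`.
-/

set_option linter.dupNamespace false
set_option autoImplicit false

namespace Summit.ValiantsHypothesis.ValiantsHypothesis.Cruxes.WeakLifting.TowerGraft

open scoped BigOperators
open Polynomial
open Summit.ValiantsHypothesis.ValiantsHypothesis.Theorems.LacunarySymmetroidMatrixDescartes
  (RealRootLawAt KPlusLogSqLaw PosRootLawOn)
open Summit.ValiantsHypothesis.ValiantsHypothesis.Theorems.LacunarySymmetroidMatrixDescartes.TropicalCensus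
  (TropRootLawAt)
open Summit.ValiantsHypothesis.ValiantsHypothesis.Theses.KPlusLogSqLaw (WeakLifting)

/-- `d` is an `m`-TOWER: every exponent exceeds `m` times every earlier one (lex chamber; forces `StrictMono d`
when `m ≥ 1`). -/
def IsTower (m : ℕ) {K : ℕ} (d : Fin K → ℕ) : Prop :=
  ∀ l l' : Fin K, l < l' → m * d l < d l'

/-- `d` is `m`-DISSOCIATED (a `B_m`-set for compositions): distinct class-count vectors `n` of total `m` give
distinct exponents `∑ n l · d l`.  Towers are dissociated; so is every generic real support. -/
def IsDissociated (m : ℕ) {K : ℕ} (d : Fin K → ℕ) : Prop :=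
  ∀ n n' : Fin K → ℕ, ∑ l, n l = m → ∑ l, n' l = m → ∑ l, n l * d l = ∑ l, n' l * d l → n = n'

/-- **TOWER-B** — the restricted V2 sub-case this idea would PROVE: Conjecture B (`KPlusLogSqLaw`, positive-root
currency `PosRootLawOn`) on tower supports, uniformly in `m` and `K`. -/
def TowerB : Prop :=
  ∃ C : ℕ, ∀ (m K : ℕ) (d : Fin K → ℕ), IsTower m d → PosRootLawOn m K (2 ^ (C * (K + Nat.log 2 m ^ 2))) d

/-- **DISSOCIATED-B** — B on all `m`-dissociated supports (by `DissociationReduction` this is ALL of B). -/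
def DissociatedB : Prop :=
  ∃ C : ℕ, ∀ (m K : ℕ) (d : Fin K → ℕ), IsDissociated m d →
    PosRootLawOn m K (2 ^ (C * (K + Nat.log 2 m ^ 2))) d

/-- **FIRST LEMMA (L1) — DISSOCIATION REDUCTION / blow-up monotonicity.**  A support-level row bound on the BLOWN-UP
support `N·d + e` (`e` dissociated, `N > m·max e`) gives the same bound on `d`: lower bounds transfer from every chamber
to its `e`-refinement (proof: `u ↦ det ∑ u^{d l + e l / N} S l → det ∑ u^{d l} S l` locally uniformly on `u > 0` as
`N → ∞`, so an alternation certificate of `d` survives at `t = u^{1/N}`; census currency via the tree's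
alternation ↔ distinct-root bridges). -/
def DissociationReduction : Prop :=
  ∀ (m K B : ℕ) (d e : Fin K → ℕ), IsDissociated m e →
    (∀ N : ℕ, (∀ l, m * e l < N) → PosRootLawOn m K B (fun l => N * d l + e l)) → PosRootLawOn m K (2 * B + 1) d

/-- corollary of (L1) with the tower tie-breaker `e l = (m+1)^l`: B is a statement about dissociated chambers only. -/
def KPlusLogSqLaw_of_dissociatedB : Prop := DissociatedB → KPlusLogSqLaw

/-- **LEMMA (L2) — TOWER DIGIT EXPANSION.**  Grafting a far letter `X^D • S` (`D > m · max d`) on a pencil `G` of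
support `d`: `det (G + X^D S) = ∑_{j ≤ m} X^{j D} · E j` where `E j` is the `T^j`-coefficient of the bivariate pencil
determinant `det (G + T·S)` and `natDegree (E j) < D` — the determinant is the base-`X^D` digit string of
`Q(X,T) = det(G + T S)`, i.e. `det F = Q(X, X^D)` with non-overlapping digits. -/
def TowerDigitExpansion : Prop :=
  ∀ (m K D : ℕ) (d : Fin K → ℕ) (S : Fin K → Matrix (Fin m) (Fin m) ℝ) (Stop : Matrix (Fin m) (Fin m) ℝ),
    (∀ l, m * d l < D) → 0 < D →
    let G : Matrix (Fin m) (Fin m) ℝ[X] := ∑ l, (X : ℝ[X]) ^ d l • (S l).map Polynomial.C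
    let Q : Polynomial ℝ[X] := (G.map (C : ℝ[X] →+* Polynomial ℝ[X]) +
      (X : Polynomial ℝ[X]) • Stop.map ((C : ℝ[X] →+* Polynomial ℝ[X]).comp (C : ℝ →+* ℝ[X]))).det
    (G + (X : ℝ[X]) ^ D • Stop.map Polynomial.C).det = ∑ j ∈ Finset.range (m + 1), (X : ℝ[X]) ^ (D * j) * Q.coeff j ∧
      ∀ j, (Q.coeff j).natDegree < D ∨ Q.coeff j = 0

/-- **THE GRAFT LAW (GL) — the crux-level target of the line.**  On a tower, grafting ONE far letter costs at most a
constant FACTOR plus a QUASI-POLYNOMIAL additive term: `ζ₊(m; d ⊔ D) ≤ 2^C · ζ₊(m; d) + 2^{C log₂² m}`.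
(The additive term is forced: `K = 3` towers are Descartes-sharp `C(m+2,2) − 1` (Disproof §D items 2/7, Vinnikov) while
`ζ₊(m;2 letters) = m`; the staircase family (L ≥ 6) lives on towers with `log ζ ≈ (K/6)·log m` at `K ≲ log m`.) -/
def TowerGraftLaw : Prop :=
  ∃ C : ℕ, ∀ (m K B D : ℕ) (d : Fin K → ℕ), IsTower m d → (∀ l, m * d l < D) →
    PosRootLawOn m K B d →
    PosRootLawOn m (K + 1) (2 ^ C * B + 2 ^ (C * Nat.log 2 m ^ 2)) (Fin.snoc d D)

/-- (GL) iterated along the tower gives TOWER-B (induction on `K`; `B_{K+1} = 2^C B_K + 2^{C L²}`, `B_1 = 0`). -/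
def TowerB_of_graftLaw : Prop := TowerGraftLaw → TowerB

/-- **Bearing on the crux.**  `WeakLifting` RESTRICTED TO TOWER SUPPORTS (a literal sub-case of stmt-19561: the
format-level tropical hypothesis, the conclusion only for tower `d`). -/
def TowerWeakLifting : Prop :=
  ∃ C : ℕ, ∀ (m K n : ℕ), TropRootLawAt m K n → ∀ (d : Fin K → ℕ), IsTower m d →
    ∀ (S : Fin K → Matrix (Fin m) (Fin m) ℝ), (∀ l, (S l).IsSymm) →
      (Matrix.det (∑ l, ((X : ℝ[X]) ^ d l) • (S l).map Polynomial.C)).roots.toFinset.card ≤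
        2 ^ (C * (K + Nat.log 2 m ^ 2)) * (n + 1)

/-- the crux gives the tower sub-case (restriction), and TOWER-B gives it with NO tropical input
(`card ≤ 2·ζ₊ + 1 ≤ 2^{(C+1)(K+L²)}·(n+1)`). -/
def TowerWeakLifting_of_weakLifting : Prop := WeakLifting → TowerWeakLifting
def TowerWeakLifting_of_towerB : Prop := TowerB → TowerWeakLifting

/-- **MECHANISM STUB (M1) — arc count.**  For a SEMIDEFINITE far letter the fibres `T ↦ Q(t,T)` are real-rooted, the
positive zero set of `Q` is a union of real-analytic branch arcs delimited by the zeros of `E 0 = det G` and of the top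
digit `E r` (a principal-compression determinant of `G`: same support, one letter fewer), and each arc meets the
monomial arc `T = t^D` at most `1 + #{points of log-slope D}` times.  Typed here in its counting consequence only. -/
def SemidefiniteGraftArcCount : Prop :=
  ∃ C : ℕ, ∀ (m K B D : ℕ) (d : Fin K → ℕ), IsTower m d → (∀ l, m * d l < D) → PosRootLawOn m K B d →
    ∀ (S : Fin K → Matrix (Fin m) (Fin m) ℝ) (P : Matrix (Fin m) (Fin m) ℝ), (∀ l, (S l).IsSymm) → P.PosSemidef →
      ((Matrix.det ((∑ l, ((X : ℝ[X]) ^ d l) • (S l).map Polynomial.C) + (X : ℝ[X]) ^ D • P.map Polynomial.C)).roots.toFinset.filter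
        (fun t => 0 < t)).card ≤ 2 ^ C * (B + m) + 2 ^ (C * Nat.log 2 m ^ 2)

/-! ## Kernel-checked compositions (no `sorry`): the line's joints are real

`towerB_of_graftLaw : TowerB_of_graftLaw` — (GL) iterated along the tower IS TowerB (induction on `K`, constant `C+1`);
`towerWeakLifting_of_weakLifting` — TowerWeakLifting is a literal sub-case of the crux;
`towerWeakLifting_of_towerB` — TowerB gives it with no tropical input (reflection `stub_negRoots`, constant `C+2`). -/

theorem posRootLawOn_mono {m K B B' : ℕ} {d : Fin K → ℕ} (hBB' : B ≤ B') (h : PosRootLawOn m K B d) :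
    PosRootLawOn m K B' d :=
  fun S hS => (h S hS).trans hBB'

/-- the empty format: with no letters the pencil is `0` (or the empty matrix), no positive zeros. -/
theorem posRootLawOn_zero (m B : ℕ) (d : Fin 0 → ℕ) : PosRootLawOn m 0 B d := by
  intro S hS
  have h0 : (∑ l : Fin 0, (Polynomial.X : Polynomial ℝ) ^ d l • (S l).map Polynomial.C) = 0 := by simp
  rw [h0]
  rcases Nat.eq_zero_or_pos m with hm | hm
  · subst hm
    simp [Matrix.det_isEmpty]
  · haveI : Nonempty (Fin m) := ⟨⟨0, hm⟩⟩
    simp [Matrix.det_zero]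

theorem isTower_init {m K : ℕ} {d : Fin (K + 1) → ℕ} (h : IsTower m d) : IsTower m (Fin.init d) :=
  fun l l' hll' => h l.castSucc l'.castSucc (Fin.castSucc_lt_castSucc_iff.mpr hll')

theorem tower_init_lt_last {m K : ℕ} {d : Fin (K + 1) → ℕ} (h : IsTower m d) (l : Fin K) :
    m * Fin.init d l < d (Fin.last K) :=
  h l.castSucc (Fin.last K) (Fin.castSucc_lt_last l)

/-- the arithmetic of one induction step: `2^C · 2^{(C+1)(K+L²)} + 2^{C L²} ≤ 2^{(C+1)(K+1+L²)}`. -/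
theorem graft_step_arith (C K L : ℕ) :
    2 ^ C * 2 ^ ((C + 1) * (K + L ^ 2)) + 2 ^ (C * L ^ 2) ≤ 2 ^ ((C + 1) * (K + 1 + L ^ 2)) := by
  have hA : C * L ^ 2 ≤ (C + 1) * (K + L ^ 2) := by nlinarith [Nat.zero_le (L ^ 2), Nat.zero_le K, Nat.zero_le C]
  have h1 : 2 ^ (C * L ^ 2) ≤ 2 ^ ((C + 1) * (K + L ^ 2)) := Nat.pow_le_pow_right two_pos hA
  have h2 : 2 ^ ((C + 1) * (K + L ^ 2)) ≤ 2 ^ C * 2 ^ ((C + 1) * (K + L ^ 2)) :=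
    Nat.le_mul_of_pos_left _ (Nat.two_pow_pos C)
  have h3 : 2 ^ ((C + 1) * (K + 1 + L ^ 2)) = 2 * (2 ^ C * 2 ^ ((C + 1) * (K + L ^ 2))) := by
    have : (C + 1) * (K + 1 + L ^ 2) = ((C + 1) * (K + L ^ 2) + C) + 1 := by ring
    rw [this, pow_succ, pow_add]; ring
  rw [h3]
  omega

/-- **(GL) iterated = TowerB.** -/
theorem towerB_of_graftLaw : TowerB_of_graftLaw := by
  rintro ⟨C, hC⟩
  refine ⟨C + 1, ?_⟩
  intro m K
  induction K with
  | zero => intro d _; exact posRootLawOn_zero m _ d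
  | succ K ih =>
    intro d hd
    have h₁ : PosRootLawOn m K (2 ^ ((C + 1) * (K + Nat.log 2 m ^ 2))) (Fin.init d) := ih (Fin.init d) (isTower_init hd)
    have h₂ := hC m K _ (d (Fin.last K)) (Fin.init d) (isTower_init hd) (tower_init_lt_last hd) h₁
    rw [Fin.snoc_init_self] at h₂
    exact posRootLawOn_mono (graft_step_arith C K (Nat.log 2 m)) h₂

/-- **TowerWeakLifting is a literal sub-case of the crux `WeakLifting`.** -/
theorem towerWeakLifting_of_weakLifting : TowerWeakLifting_of_weakLifting := by
  rintro ⟨C, hC⟩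
  exact ⟨C, fun m K n hT d _ S hS => hC m K n hT d S hS⟩

/-- **TowerB gives the tower sub-case with no tropical input** (`card ≤ Z₊(S) + Z₊(reflected S) + 1`). -/
theorem towerWeakLifting_of_towerB : TowerWeakLifting_of_towerB := by
  rintro ⟨C, hC⟩
  refine ⟨C + 2, fun m K n _ d hd S hS => ?_⟩
  rcases Nat.eq_zero_or_pos K with hK | hK
  · subst hK
    have h0 : (∑ l : Fin 0, (Polynomial.X : Polynomial ℝ) ^ d l • (S l).map Polynomial.C) = 0 := by simp
    rw [h0]
    rcases Nat.eq_zero_or_pos m with hm | hm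
    · subst hm; simp [Matrix.det_isEmpty]
    · haveI : Nonempty (Fin m) := ⟨⟨0, hm⟩⟩
      simp [Matrix.det_zero]
  · have h1 := hC m K d hd S hS
    have h2 := hC m K d hd (fun l => ((-1 : ℝ) ^ d l) • S l) (fun l => (hS l).smul _)
    have h3 := Summit.ValiantsHypothesis.ValiantsHypothesis.Theorems.LacunarySymmetroidMatrixDescartes.stub_negRoots K m d S
    set A := C * (K + Nat.log 2 m ^ 2) with hAdef
    have h4 : 2 ^ A + 2 ^ A + 1 ≤ 2 ^ ((C + 2) * (K + Nat.log 2 m ^ 2)) * (n + 1) := by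
      have h5 : (C + 2) * (K + Nat.log 2 m ^ 2) = A + 2 * (K + Nat.log 2 m ^ 2) := by rw [hAdef]; ring
      have h6 : 2 ≤ 2 * (K + Nat.log 2 m ^ 2) := by omega
      have h7 : 2 ^ 2 ≤ 2 ^ (2 * (K + Nat.log 2 m ^ 2)) := Nat.pow_le_pow_right two_pos h6
      have h8 : 1 ≤ 2 ^ A := Nat.one_le_two_pow
      calc 2 ^ A + 2 ^ A + 1 ≤ 2 ^ A * 2 ^ 2 := by omega
        _ ≤ 2 ^ A * 2 ^ (2 * (K + Nat.log 2 m ^ 2)) := Nat.mul_le_mul_left _ h7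
        _ = 2 ^ ((C + 2) * (K + Nat.log 2 m ^ 2)) := by rw [h5, pow_add]
        _ ≤ 2 ^ ((C + 2) * (K + Nat.log 2 m ^ 2)) * (n + 1) := Nat.le_mul_of_pos_right _ (Nat.succ_pos n)
    exact h3.trans ((Nat.add_le_add (Nat.add_le_add h1 h2) le_rfl).trans h4)

end Summit.ValiantsHypothesis.ValiantsHypothesis.Cruxes.WeakLifting.TowerGraft
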